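import Summits.CriticalPhenomena.PercolationContinuityZ3.Theorems.Transplant.FKConnectivityAllQHubCovFiber
import Summits.CriticalPhenomena.PercolationContinuityZ3.Theorems.Transplant.FKConnectivityAllQLoops
import Summits.CriticalPhenomena.PercolationContinuityZ3.Theorems.PercNearOneGluingNoHeavyLowerTailFKExactEval
import HarnessLib

/-!
# Connectivity correlation inequalities for `φ_{w,q}`, every `q > 0` — the hub covariance bound from FIBER POLYNOMIALS
# (support-restricted), loop erasure for the bound, and the fibers of a LISTED graph as a powerset

Helper file (`--supports stmt-CriticalPhenomena-4575`), FK sub-lane `prim-bschramm-fk-3` (gen 10) of the post-continuity programme;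
builds on p205010 (kernel theorem, internal audit signed; external expert review pending).  No definitions, no named facts, no sorries;
standard axioms.  This is the abstract third of the `K₅` kernel certificate (`…K5CellsDefs`, `…K5CellsReflect`, `…K5CellsDecide*`,
`…K5`); everything here is stated for an arbitrary finite vertex type / an arbitrary listed graph `FK.RCEval`.

* `hubCovBoundUnder_of_fiberPoly_supp` — fk-1 g6's fiber decomposition (`threePoint_eq_fiber_sum`: the three-point expression of
  fk-3 g7's `HubCovBoundUnder (φ_{U,q}) q x y z` is `Σ_{(I,J)} c_U(I,J)·P_{I,J}(q)` with `c_U ≥ 0`) with the per-fiber hypothesis taken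
  to be NONNEGATIVITY OF THE FIBER POLYNOMIAL `P_{I,J}(q)` itself (not the counting criterion of `…HubCovFiberSupp`), and required
  only on the fibers that carry weight (`U ≠ 0` on `J`, `U ≠ 1` off `I`).
* `hubCovBoundUnder_eraseLoops_iff` — the bound for `φ_w` is the bound for `φ_{w°}`, `w°` = `w` with every loop parameter set to
  `0` (connection events ignore loops; gen 6's `rcMeasureW_real_eraseLoops`).
* For a listed graph `D : FK.RCEval` (gen 5: configurations `D.conf t`, `t ⊆ Fin m`): `conf_union`, `conf_inter`, `conf_subset_conf_iff`,
  and **`fiber_eq_image_powerset`** — the fiber `{(ω₁,ω₂) : ω₁ ∩ ω₂ = conf I, ω₁ ∪ ω₂ = conf J}` (`I ⊆ J`) is the injective image of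
  the powerset of `J \ I` under `T ↦ (conf (I ∪ T), conf (J \ T))`; hence `sum_fiber_eq_sum_powerset` and
  **`hubCovBoundUnder_of_listed`**: for a weight vector supported in the listed pairs, nonnegativity of
  `Σ_{T ⊆ J \ I} q^{k(conf(I∪T)) + k(conf(J\T))} σ(conf(I∪T), conf(J\T))` for all `I ⊆ J ⊆ Fin m` gives the hub covariance bound —
  the form a finite `decide` certificate can discharge.
[cite: Grimmett2006, §1.4 eq. (1.20) (p. 15); §3.9 eq. (3.94) (pp. 63–64)] [cite: Wagner2006, Conj. 5.3, Ex. 5.2 (p. 13)]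
-/

noncomputable section

namespace Summit.CriticalPhenomena.PercolationContinuityZ3.Theorems

namespace FK

open MeasureTheory Finset Literature.Probability.LatticeModels Literature.Probability.Percolation
open Literature.Probability.Percolation.DecisionTree (ind ind_of_mem ind_of_not_mem ind_nonneg)
open scoped Classical symmDiff

variable {V : Type*} [Fintype V]

/-! ### The bound from nonnegative fiber polynomials (support-restricted) -/

/-- **Hub covariance bound from nonnegative fiber polynomials, SUPPORT-RESTRICTED** (`0 < q`): if for every fiber `(I, J)` that
carries weight under `U` (`U ≠ 0` on `J`, `U ≠ 1` off `I`) the fiber polynomial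
`Σ_{ω₁∩ω₂ = I, ω₁∪ω₂ = J} q^{k(ω₁)+k(ω₂)} (1_{x∤y~z}(ω₁) + (1−q)(1_{xy|z}(ω₁)1_{xz|y}(ω₂) − 1_{xyz}(ω₁)(1_{x∤y~z}(ω₂) + 1_{x|y|z}(ω₂))))`
is `≥ 0`, then `HubCovBoundUnder (φ_{U,q}) q x y z`. (fk-1 g6's `threePoint_eq_fiber_sum` + `fiberWeight_nonneg`.)
[cite: Wagner2006, Conj. 5.3, Ex. 5.2 (p. 13)] [cite: Grimmett2006, §3.9 eq. (3.94) (pp. 63–64); §1.4 eq. (1.20) (p. 15)] -/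
theorem hubCovBoundUnder_of_fiberPoly_supp {q : ℝ} (hq0 : 0 < q) (U : Sym2 V → unitInterval) (x y z : V)
    (hpoly : ∀ (d : BondConfig V × BondConfig V), (∀ g, g ∈ d.2 → ((U g : unitInterval) : ℝ) ≠ 0) →
      (∀ g, g ∉ d.1 → ((U g : unitInterval) : ℝ) ≠ 1) →
      0 ≤ ∑ pr ∈ (Finset.univ : Finset (BondConfig V × BondConfig V)).filter (fun pr => (pr.1 ∩ pr.2, pr.1 ∪ pr.2) = d),
          q ^ (clusterCount pr.1 ∅ + clusterCount pr.2 ∅) *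
            (ind ((openConn x y : Set (BondConfig V))ᶜ ∩ openConn y z) pr.1 +
              (1 - q) * (ind (openConn x y ∩ (openConn x z : Set (BondConfig V))ᶜ) pr.1 *
                  ind ((openConn x y : Set (BondConfig V))ᶜ ∩ openConn x z) pr.2 -
                ind (openConn x y ∩ openConn x z) pr.1 *
                  (ind ((openConn x y : Set (BondConfig V))ᶜ ∩ openConn y z) pr.2 +
                    ind ((openConn x y : Set (BondConfig V))ᶜ ∩ (openConn x z : Set (BondConfig V))ᶜ ∩
                      (openConn y z : Set (BondConfig V))ᶜ) pr.2)))) :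
    HubCovBoundUnder (rcMeasureW U q ∅) q x y z := by
  rw [hubCovBoundUnder_iff_threePoint hq0, threePoint_eq_fiber_sum]
  refine Finset.sum_nonneg fun d _ => ?_
  -- fibers that carry no weight contribute nothing
  by_cases hz : ∃ g, (g ∈ d.2 ∧ ((U g : unitInterval) : ℝ) = 0) ∨ (g ∉ d.1 ∧ ((U g : unitInterval) : ℝ) = 1)
  · obtain ⟨g, hg⟩ := hz
    have hc : (∏ g : Sym2 V, (if g ∈ d.1 then (U g : ℝ) * (U g : ℝ) else if g ∈ d.2 then (U g : ℝ) * (1 - (U g : ℝ))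
        else (1 - (U g : ℝ)) * (1 - (U g : ℝ)))) = 0 := by
      refine Finset.prod_eq_zero (Finset.mem_univ g) ?_
      rcases hg with ⟨hg2, h0⟩ | ⟨hg1, h1⟩
      · by_cases hg1 : g ∈ d.1
        · rw [if_pos hg1, h0, mul_zero]
        · rw [if_neg hg1, if_pos hg2, h0, zero_mul]
      · rw [if_neg hg1]
        by_cases hg2 : g ∈ d.2
        · rw [if_pos hg2, h1, sub_self, mul_zero]
        · rw [if_neg hg2, h1, sub_self, mul_zero]
    rw [hc, zero_mul]
  have hs0 : ∀ g, g ∈ d.2 → ((U g : unitInterval) : ℝ) ≠ 0 := fun g hg h0 => hz ⟨g, Or.inl ⟨hg, h0⟩⟩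
  have hs1 : ∀ g, g ∉ d.1 → ((U g : unitInterval) : ℝ) ≠ 1 := fun g hg h1 => hz ⟨g, Or.inr ⟨hg, h1⟩⟩
  exact mul_nonneg (fiberWeight_nonneg _ (fun g => (U g).2.1) (fun g => (U g).2.2) _ _) (hpoly d hs0 hs1)

/-! ### Loop erasure for the bound -/

omit [Fintype V] in
/-- Toggling a loop does not change the open graph (`fromEdgeSet` ignores diagonal pairs). [folklore] -/
theorem openGraph_symmDiff_loop (ω : BondConfig V) (v : V) : openGraph (ω ∆ {s(v, v)}) = openGraph ω := by
  ext a b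
  simp only [openGraph_adj, Set.mem_symmDiff, Set.mem_singleton_iff]
  constructor
  · rintro ⟨h | h, hab⟩
    · exact ⟨h.1, hab⟩
    · exact absurd (Sym2.mk_isDiag_iff.1 (h.1 ▸ Sym2.mk_isDiag_iff.2 rfl : (s(a, b) : Sym2 V).IsDiag)) hab
  · rintro ⟨h, hab⟩
    refine ⟨Or.inl ⟨h, fun he => hab ?_⟩, hab⟩
    exact Sym2.mk_isDiag_iff.1 (he ▸ Sym2.mk_isDiag_iff.2 rfl : (s(a, b) : Sym2 V).IsDiag)

omit [Fintype V] in
/-- Connection events are insensitive to loops. [folklore] -/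
theorem openConn_symmDiff_loop (a b v : V) (ω : BondConfig V) : ω ∆ {s(v, v)} ∈ openConn a b ↔ ω ∈ openConn a b := by
  rw [mem_openConn_iff', mem_openConn_iff', openGraph_symmDiff_loop]

/-- **Loop erasure for the hub covariance bound** (`0 < q`): with `w° e = 0` on diagonal pairs and `w° e = w e` otherwise,
`HubCovBoundUnder (φ_w) q x y z ↔ HubCovBoundUnder (φ_{w°}) q x y z` (the five events of the bound are connection events).
[cite: Grimmett2006, §1.4 eq. (1.20) (p. 15); §3.9 eq. (3.94) (p. 63)] -/
theorem hubCovBoundUnder_eraseLoops_iff {q : ℝ} (hq : 0 < q) (w : Sym2 V → unitInterval) (x y z : V) :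
    HubCovBoundUnder (rcMeasureW w q ∅) q x y z ↔
      HubCovBoundUnder (rcMeasureW (fun e => if e.IsDiag then (0 : unitInterval) else w e) q ∅) q x y z := by
  unfold HubCovBoundUnder
  have hT : ∀ v : V, ∀ ω : BondConfig V, ω ∆ {s(v, v)} ∈ (openConn x y ∩ openConn x z : Set (BondConfig V)) ↔
      ω ∈ (openConn x y ∩ openConn x z : Set (BondConfig V)) := fun v ω => by
    simp only [Set.mem_inter_iff, openConn_symmDiff_loop]
  have hC : ∀ v : V, ∀ ω : BondConfig V, ω ∆ {s(v, v)} ∈ ((openConn x y : Set (BondConfig V))ᶜ ∩ openConn y z : Set (BondConfig V)) ↔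
      ω ∈ ((openConn x y : Set (BondConfig V))ᶜ ∩ openConn y z : Set (BondConfig V)) := fun v ω => by
    simp only [Set.mem_inter_iff, Set.mem_compl_iff, openConn_symmDiff_loop]
  have hU : ∀ v : V, ∀ ω : BondConfig V, ω ∆ {s(v, v)} ∈ (Set.univ : Set (BondConfig V)) ↔ ω ∈ (Set.univ : Set (BondConfig V)) :=
    fun v ω => by simp only [Set.mem_univ]
  rw [rcMeasureW_real_eraseLoops w hq _ hT, rcMeasureW_real_eraseLoops w hq _ (openConn_symmDiff_loop x y),
    rcMeasureW_real_eraseLoops w hq _ (openConn_symmDiff_loop x z), rcMeasureW_real_eraseLoops w hq _ hC,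
    rcMeasureW_real_eraseLoops w hq _ hU]

/-! ### Fibers of a listed graph -/

namespace RCEval

variable {D : RCEval}

/-- `conf` turns unions into unions. [folklore] -/
theorem conf_union (s t : Finset (Fin D.m)) : D.conf (s ∪ t) = D.conf s ∪ D.conf t := by
  unfold RCEval.conf
  rw [Finset.image_union, Finset.coe_union]

/-- Under validity `conf` turns intersections into intersections. [folklore] -/
theorem conf_inter (hD : D.Valid) (s t : Finset (Fin D.m)) : D.conf (s ∩ t) = D.conf s ∩ D.conf t := by
  unfold RCEval.conf
  rw [Finset.image_inter _ _ hD.1, Finset.coe_inter]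

/-- Under validity `conf s ⊆ conf t ↔ s ⊆ t`. [folklore] -/
theorem conf_subset_conf_iff (hD : D.Valid) (s t : Finset (Fin D.m)) : D.conf s ⊆ D.conf t ↔ s ⊆ t := by
  constructor
  · intro h i hi
    exact (edge_mem_conf hD t i).1 (h ((edge_mem_conf hD s i).2 hi))
  · intro h e he
    obtain ⟨i, hi, rfl⟩ := Finset.mem_image.1 (Finset.mem_coe.1 he)
    exact (edge_mem_conf hD t i).2 (h hi)

/-- For `I ⊆ J` and `T ⊆ J \ I`: `(I ∪ T) ∩ (J \ T) = I`. [folklore] -/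
theorem union_inter_sdiff_eq {α : Type*} [DecidableEq α] {I J T : Finset α} (hIJ : I ⊆ J) (hT : T ⊆ J \ I) :
    (I ∪ T) ∩ (J \ T) = I := by
  ext e
  simp only [Finset.mem_inter, Finset.mem_union, Finset.mem_sdiff]
  constructor
  · rintro ⟨h1 | h1, h2, h3⟩
    · exact h1
    · exact absurd h1 h3
  · intro h
    exact ⟨Or.inl h, hIJ h, fun hT' => (Finset.mem_sdiff.1 (hT hT')).2 h⟩

/-- For `I ⊆ J` and `T ⊆ J \ I`: `(I ∪ T) ∪ (J \ T) = J`. [folklore] -/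
theorem union_union_sdiff_eq {α : Type*} [DecidableEq α] {I J T : Finset α} (hIJ : I ⊆ J) (hT : T ⊆ J \ I) :
    (I ∪ T) ∪ (J \ T) = J := by
  ext e
  simp only [Finset.mem_union, Finset.mem_sdiff]
  constructor
  · rintro ((h | h) | ⟨h, -⟩)
    · exact hIJ h
    · exact (Finset.mem_sdiff.1 (hT h)).1
    · exact h
  · intro h
    by_cases hT' : e ∈ T
    · exact Or.inl (Or.inr hT')
    · exact Or.inr ⟨h, hT'⟩

/-- **The fiber over `(conf I, conf J)` is the powerset of `J \ I`** (`I ⊆ J`, validity): the pairs `(ω₁, ω₂)` with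
`ω₁ ∩ ω₂ = conf I`, `ω₁ ∪ ω₂ = conf J` are exactly `(conf (I ∪ T), conf (J \ T))`, `T ⊆ J \ I`. [cite: Grimmett2006, §1.4 eq. (1.20) (p. 15)] -/
theorem fiber_eq_image_powerset (hD : D.Valid) {I J : Finset (Fin D.m)} (hIJ : I ⊆ J) :
    (Finset.univ : Finset (BondConfig (Fin D.n) × BondConfig (Fin D.n))).filter
        (fun pr => (pr.1 ∩ pr.2, pr.1 ∪ pr.2) = (D.conf I, D.conf J)) =
      ((J \ I).powerset).image (fun T => (D.conf (I ∪ T), D.conf (J \ T))) := by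
  ext ⟨p₁, p₂⟩
  simp only [Finset.mem_filter, Finset.mem_univ, true_and, Finset.mem_image, Finset.mem_powerset, Prod.mk.injEq]
  constructor
  · rintro ⟨h1, h2⟩
    -- both coordinates use listed pairs only
    have hr1 : p₁ ⊆ Set.range D.edge := fun e he => conf_subset_range J (h2 ▸ Set.mem_union_left _ he)
    have hr2 : p₂ ⊆ Set.range D.edge := fun e he => conf_subset_range J (h2 ▸ Set.mem_union_right _ he)
    obtain ⟨t₁, rfl⟩ := exists_conf_eq_of_subset hr1
    obtain ⟨t₂, rfl⟩ := exists_conf_eq_of_subset hr2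
    rw [← conf_inter hD] at h1
    rw [← conf_union] at h2
    have hi : t₁ ∩ t₂ = I := conf_injective hD h1
    have hu : t₁ ∪ t₂ = J := conf_injective hD h2
    refine ⟨t₁ \ I, ?_, ?_⟩
    · intro e he
      rw [Finset.mem_sdiff] at he ⊢
      exact ⟨hu ▸ Finset.mem_union_left _ he.1, he.2⟩
    · have e1 : I ∪ t₁ \ I = t₁ := Finset.union_sdiff_of_subset (hi ▸ Finset.inter_subset_left)
      have e2 : J \ (t₁ \ I) = t₂ := by
        ext e
        rw [← hu, ← hi]
        simp only [Finset.mem_sdiff, Finset.mem_union, Finset.mem_inter]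
        tauto
      rw [e1, e2]
      exact ⟨rfl, rfl⟩
  · rintro ⟨T, hT, h⟩
    obtain ⟨rfl, rfl⟩ := h
    rw [← conf_inter hD, ← conf_union, union_inter_sdiff_eq hIJ hT, union_union_sdiff_eq hIJ hT]
    exact ⟨rfl, rfl⟩

/-- The parametrisation `T ↦ (conf (I ∪ T), conf (J \ T))` of the fiber is injective on the powerset of `J \ I`. [folklore] -/
theorem pairOfPowerset_injOn (hD : D.Valid) (I J : Finset (Fin D.m)) :
    Set.InjOn (fun T : Finset (Fin D.m) => (D.conf (I ∪ T), D.conf (J \ T))) ↑((J \ I).powerset) := by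
  intro T₁ h₁ T₂ h₂ h
  have h₁' : T₁ ⊆ J \ I := Finset.mem_powerset.1 (Finset.mem_coe.1 h₁)
  have h₂' : T₂ ⊆ J \ I := Finset.mem_powerset.1 (Finset.mem_coe.1 h₂)
  have hu : I ∪ T₁ = I ∪ T₂ := conf_injective hD (Prod.mk.inj h).1
  ext e
  constructor
  · intro he
    have : e ∈ I ∪ T₂ := hu ▸ Finset.mem_union_right _ he
    rcases Finset.mem_union.1 this with h | h
    · exact absurd h (Finset.mem_sdiff.1 (h₁' he)).2
    · exact h
  · intro he
    have : e ∈ I ∪ T₁ := hu.symm ▸ Finset.mem_union_right _ he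
    rcases Finset.mem_union.1 this with h | h
    · exact absurd h (Finset.mem_sdiff.1 (h₂' he)).2
    · exact h

/-- **A sum over a fiber of a listed graph is a sum over a powerset.** [cite: Grimmett2006, §1.4 eq. (1.20) (p. 15)] -/
theorem sum_fiber_eq_sum_powerset (hD : D.Valid) {I J : Finset (Fin D.m)} (hIJ : I ⊆ J)
    (f : BondConfig (Fin D.n) × BondConfig (Fin D.n) → ℝ) :
    ∑ pr ∈ (Finset.univ : Finset (BondConfig (Fin D.n) × BondConfig (Fin D.n))).filter
        (fun pr => (pr.1 ∩ pr.2, pr.1 ∪ pr.2) = (D.conf I, D.conf J)), f pr =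
      ∑ T ∈ (J \ I).powerset, f (D.conf (I ∪ T), D.conf (J \ T)) := by
  rw [fiber_eq_image_powerset hD hIJ, Finset.sum_image (pairOfPowerset_injOn hD I J)]

/-- **The hub covariance bound for a weight vector supported in a listed graph, from its powerset sums** (`0 < q`): if `U`
vanishes off the listed pairs of `D` and for all `I ⊆ J ⊆ Fin m`
`0 ≤ Σ_{T ⊆ J \ I} q^{k(conf(I∪T)) + k(conf(J\T))} σ(conf (I ∪ T), conf (J \ T))` (`σ` the fiber sign of
`hubCovBoundUnder_of_fiberPoly_supp`), then `HubCovBoundUnder (φ_{U,q}) q x y z`. [cite: Grimmett2006, §1.4 eq. (1.20) (p. 15); §3.9 eq. (3.94) (pp. 63–64)]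
[cite: Wagner2006, Conj. 5.3, Ex. 5.2 (p. 13)] -/
theorem hubCovBoundUnder_of_listed (hD : D.Valid) {q : ℝ} (hq0 : 0 < q) (U : Sym2 (Fin D.n) → unitInterval)
    (hU : ∀ e, ((U e : unitInterval) : ℝ) ≠ 0 → e ∈ Set.range D.edge) (x y z : Fin D.n)
    (hpoly : ∀ I J : Finset (Fin D.m), I ⊆ J →
      0 ≤ ∑ T ∈ (J \ I).powerset,
          q ^ (clusterCount (D.conf (I ∪ T)) ∅ + clusterCount (D.conf (J \ T)) ∅) *
            (ind ((openConn x y : Set (BondConfig (Fin D.n)))ᶜ ∩ openConn y z) (D.conf (I ∪ T)) +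
              (1 - q) * (ind (openConn x y ∩ (openConn x z : Set (BondConfig (Fin D.n)))ᶜ) (D.conf (I ∪ T)) *
                  ind ((openConn x y : Set (BondConfig (Fin D.n)))ᶜ ∩ openConn x z) (D.conf (J \ T)) -
                ind (openConn x y ∩ openConn x z) (D.conf (I ∪ T)) *
                  (ind ((openConn x y : Set (BondConfig (Fin D.n)))ᶜ ∩ openConn y z) (D.conf (J \ T)) +
                    ind ((openConn x y : Set (BondConfig (Fin D.n)))ᶜ ∩ (openConn x z : Set (BondConfig (Fin D.n)))ᶜ ∩
                      (openConn y z : Set (BondConfig (Fin D.n)))ᶜ) (D.conf (J \ T)))))) :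
    HubCovBoundUnder (rcMeasureW U q ∅) q x y z := by
  refine hubCovBoundUnder_of_fiberPoly_supp hq0 U x y z fun d h0 _ => ?_
  -- an empty fiber contributes `0`
  by_cases hne : ((Finset.univ : Finset (BondConfig (Fin D.n) × BondConfig (Fin D.n))).filter
      (fun pr => (pr.1 ∩ pr.2, pr.1 ∪ pr.2) = d)).Nonempty
  swap
  · rw [Finset.not_nonempty_iff_eq_empty.1 hne, Finset.sum_empty]
  obtain ⟨pr, hpr⟩ := hne
  have hd : (pr.1 ∩ pr.2, pr.1 ∪ pr.2) = d := (Finset.mem_filter.1 hpr).2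
  -- the fiber is `(conf I, conf J)` with `I ⊆ J`
  have h2 : d.2 ⊆ Set.range D.edge := fun e he => hU e (h0 e he)
  have h12 : d.1 ⊆ d.2 := by
    rw [← hd]
    exact fun e he => Set.mem_union_left _ he.1
  obtain ⟨J, hJ⟩ := exists_conf_eq_of_subset h2
  obtain ⟨I, hI⟩ := exists_conf_eq_of_subset (h12.trans h2)
  have hIJ : I ⊆ J := (conf_subset_conf_iff hD I J).1 (hI.symm ▸ hJ.symm ▸ h12)
  obtain ⟨d1, d2⟩ := d
  simp only at hI hJ
  subst hI hJ
  rw [sum_fiber_eq_sum_powerset hD hIJ]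
  exact hpoly I J hIJ

end RCEval

end FK

end Summit.CriticalPhenomena.PercolationContinuityZ3.Theorems

end
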